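import Summits.BirchSwinnertonDyer.BirchSwinnertonDyer.Theorems.AlignedTransportAtTwoMainConjectureOfRankZeroBSDAtTwoHalfDescentBaseIndexSelmer
import Summits.BirchSwinnertonDyer.BirchSwinnertonDyer.Theorems.AlignedTransportAtTwoMainConjectureOfRankZeroBSDAtTwoHalfDescentLayerIndexBounded
import Summits.BirchSwinnertonDyer.BirchSwinnertonDyer.Theorems.AlignedTransportAtTwoMainConjectureOfRankZeroBSDAtTwoHalfDescentLayerIndexGrowthEventual
import Summits.BirchSwinnertonDyer.BirchSwinnertonDyer.Theorems.AlignedTransportAtTwoMainConjectureOfRankZeroBSDAtTwoHalfDescentLayerIndexGrowthFiniteCompleteTwo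
import HarnessLib

/-!
# Route `AlignedTransportAtTwo`, crux C2 `MainConjectureOfRankZeroBSDAtTwo` (stmt-BirchSwinnertonDyer-22298):
# THE BASE TERM CARRIES `p^μ`, IV — COMPLETENESS OF THE `γ`-FREE DOOR: in a rank-`0` tower `μ(X) = 0 ⟺ ∃ n, 0 < #(X/ω_nX) < p^{pⁿ}`; in Selmer currency
# `μ = 0 ⟺ ∃ n, 0 < #Sel_{p^∞}(E/K_∞)^{Γ_n} < p^{pⁿ}` and, with the restriction kernels `ker h_n` bounded (over `ℚ`: ALWAYS, tree), `μ = 0 ⟺ ∃ n, 0 < #Sel_{p^∞}(E/K_n)·#ker g_n < p^{pⁿ}`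
# — NO bound on Greenberg's `ker g_n` is needed (Lemma 4.3 puts it on the finite-level side), so over `ℚ` the door is complete at EVERY prime and EVERY reduction type

HONEST FRAMING (cell `bsd-f1-sign2`, WIDTH-5 attached prover seat `bsd-line-att-p5` gen 60 on line `birth` of the lead `bsd-line-att-p2`;
`--supports` stmt-BirchSwinnertonDyer-22298, closes nothing; BSD is NOT proved by any of this; the crux C2, its verdict «blocked-on
`Rank1Residual.GreenbergMuConjectureIrreducible`» and every registered stub (P / T / Kμ / LimDoor / MuIneqʳ / PFμ⁺) are untouched). THEOREMS ONLY — no `def`,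
no instance, no named fact, no `sorry`. Route-independent. Sequel of this gen's `…BaseIndex` / `…BaseIndexSelmer` (`p^{pⁿ·μ} ∣ #(X/ω_nX) = #Sel_∞^{Γ_n}`,
`p^{pⁿ·μ} ∣ #Sel_{p^∞}(E/K_n)·#ker g_n`, the doors) with gen 56's eventual Iwasawa formula for ARBITRARY f.g. torsion modules in a rank-`0` tower
(`…LayerIndexGrowthEventual.exists_forall_natCard_quotient_omega_mul_pow_eq`: `#(X/ω_nX)·p^{μp^{n₁}+λn₁} = #(X/ω_{n₁}X)·p^{μpⁿ+λn}`, `n ≥ n₁`), gen 55's `exists_linear_lt_pow`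
and gen 57's `…GrowthFiniteCompleteTwo.exists_forall_natCard_ker_layerToInfty_pos_le` (over `ℚ`: `∃ T, ∀ n, 0 < #ker h_n ≤ T`, any `p`, any `ℤ_p`-extension, any `E`).
Gen 57's finite-level door (`#((γ^{pⁿ}−1)·Sel_{n+1})·#ker g_{n+1} < p^{pⁿ(p−1)}`) is complete under bounded `ker h` AND bounded `ker g` (over `ℚ` at `2`: good ORDINARY only,
Greenberg L.3.5); the `γ`-free door needs bounded `ker h` ONLY — hence complete over `ℚ` with NO reduction hypothesis at `p`.

THE POINT. RANK-`0` TOWER throughout: `char_Λ X = (f)`, `f(0) ≠ 0`, `Ψ_m ∤ f` for all `m` (all `X/ω_nX` finite).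
* §1 (module, any `p`) ★ `natCard_quotient_omega_pos`: **`0 < #(X/ω_nX)`** at every layer of a rank-`0` tower (finite submodules allowed);
  ★★ `exists_forall_natCard_quotient_omega_pos_le`: `μ(f) = 0 ⟹ ∃ n₁ C > 0, ∀ n ≥ n₁, 0 < #(X/ω_nX) ≤ C·p^{λ(f)·n}`; ★ `exists_linear_lt_pow'` (`a·n + b < pⁿ` for large `n`);
  ★★★ **`mu_eq_zero_iff_exists_natCard_quotient_omega_pos_lt`: `μ(f) = 0 ⟺ ∃ n, 0 < #(X/ω_nX) < p^{pⁿ}`**, and with a bounded extra factor `T`: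
  `exists_natCard_quotient_omega_mul_lt_pow` (`μ = 0 ⟹ ∃ n, #(X/ω_nX)·T < p^{pⁿ}`).
* §2 (Selmer, any `K`, `p`, `κ`) ★★★ `mu_eq_zero_iff_exists_natCard_selmerInvariants_pos_lt_pow`: **`μ = 0 ⟺ ∃ n, 0 < #Sel_{p^∞}(E/K_∞)^{Γ_n} < p^{pⁿ}`**;
  ★★★ `mu_eq_zero_iff_exists_natCard_selmerLayer_mul_kerG_lt`: bounded `ker h` ⟹ **`μ = 0 ⟺ ∃ n, 0 < #Sel_{p^∞}(E/K_n)·#ker g_n < p^{pⁿ}`**.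
* §3 (`K = ℚ`, ANY `p`, ANY `E/ℚ`, ANY reduction) ★★★ **`mu_eq_zero_iff_exists_natCard_selmerLayer_mul_kerG_lt_rat`: `μ(X(E/ℚ_∞)) = 0 ⟺ ∃ n, 0 < #Sel_{p^∞}(E/ℚ_n)·#ker g_n(E/ℚ_n) < p^{pⁿ}`**
  for every dual datum in the rank-`0` tower — the `γ`-free door is COMPLETE over `ℚ` unconditionally.
Reading for C2 (`p = 2`, seed cell, rank-`0` tower): road (a)'s stub T at a seed `W` IS the existence of ONE layer `ℚ_n` with `#Ш(W/ℚ_n)[2^∞]·#ker g_n < 2^{2ⁿ}` (rank `0` at `ℚ_n`);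
for the `λ_an = 2` anchors the first candidate layer is `n = 2` or `3` (`2^{λn+ν}·#ker g_n` against `16`, `256`). Nothing numerical is asserted; C2 untouched.
Memo `Cruxes/MainConjectureOfRankZeroBSDAtTwo/BASE-TERM-att-p5-g60.md`.

References: R. Greenberg, LNM 1716 (1999), Thm. 1.10, Conj. 1.11, §3 Lemmas 3.1–3.5, §4 Lemmas 4.2–4.3 [GreenbergLNM1716]; L. Washington, GTM 83, §13.3 Thm. 13.13
[Washington1997]; B. Mazur, Invent. Math. 18 (1972) §6 [Mazur1972].
-/

set_option linter.dupNamespace false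
set_option autoImplicit false

noncomputable section

open scoped Classical Polynomial

universe u

namespace Summit.BirchSwinnertonDyer.BirchSwinnertonDyer.Theorems.AlignedTransportAtTwoHalfDescentBaseIndexComplete

open WeierstrassCurve Literature.NumberTheory.EllipticCurves Literature.NumberTheory.EllipticCurves.IwasawaAlgebra
  Summit.BirchSwinnertonDyer.Rank1Residual.X1.MuLambda
  Summit.BirchSwinnertonDyer.Rank1Residual.X1.ParitySqueeze
  Summit.BirchSwinnertonDyer.Rank1Residual.X1.GeneratorBoundMu
  Summit.BirchSwinnertonDyer.Rank1Residual.Iwasawa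
  Summit.BirchSwinnertonDyer.BirchSwinnertonDyer.Theorems.DefectPrime
  Summit.BirchSwinnertonDyer.BirchSwinnertonDyer.Theorems.AlignedTransportAtTwoCyclotomicLayerPrime
  Summit.BirchSwinnertonDyer.BirchSwinnertonDyer.Theorems.AlignedTransportAtTwoHalfDescentLayerIndex
  Summit.BirchSwinnertonDyer.BirchSwinnertonDyer.Theorems.AlignedTransportAtTwoHalfDescentLayerIndexTower
  Summit.BirchSwinnertonDyer.BirchSwinnertonDyer.Theorems.AlignedTransportAtTwoHalfDescentLayerIndexFinite
  Summit.BirchSwinnertonDyer.BirchSwinnertonDyer.Theorems.AlignedTransportAtTwoHalfDescentLayerIndexCertificate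
  Summit.BirchSwinnertonDyer.BirchSwinnertonDyer.Theorems.AlignedTransportAtTwoHalfDescentLayerIndexBounded
  Summit.BirchSwinnertonDyer.BirchSwinnertonDyer.Theorems.AlignedTransportAtTwoHalfDescentLayerIndexGrowthExact
  Summit.BirchSwinnertonDyer.BirchSwinnertonDyer.Theorems.AlignedTransportAtTwoHalfDescentLayerIndexGrowthEventual
  Summit.BirchSwinnertonDyer.BirchSwinnertonDyer.Theorems.AlignedTransportAtTwoHalfDescentLayerIndexSelmer
  Summit.BirchSwinnertonDyer.BirchSwinnertonDyer.Theorems.AlignedTransportAtTwoHalfDescentLayerIndexGrowthFiniteCompleteTwo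
  Summit.BirchSwinnertonDyer.BirchSwinnertonDyer.Theorems.AlignedTransportAtTwoHalfDescentBaseRing
  Summit.BirchSwinnertonDyer.BirchSwinnertonDyer.Theorems.AlignedTransportAtTwoHalfDescentBaseIndex
  Summit.BirchSwinnertonDyer.BirchSwinnertonDyer.Theorems.AlignedTransportAtTwoHalfDescentBaseIndexSelmer

/-! ## §1 Rank-`0` tower, module form: positivity, the eventual bound under `μ = 0`, completeness -/

section Module

variable {p : ℕ} [hp : Fact p.Prime] {M : Type u} [AddCommGroup M] [Module (IwasawaAlgebra p) M]

/-- ★ **Every `X/ω_nX` is finite in a rank-`0` tower**: `X` f.g. torsion, `char_Λ X = (f)`, `f(0) ≠ 0`, `Ψ_m ∤ f` for `m < n` ⟹ `0 < #(X/ω_nX)` (finite submodules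
allowed: `#(X/ω_nX) = #((X/F)/ω_n)·#(F/ω_nF)` with `#((X/F)/ω_n) = #((X/F)/T)·∏_{m<n} #((X/F)/Ψ_m)`, every factor positive). [cite: Washington1997, §13.3 (Lemma 13.18)] -/
theorem natCard_quotient_omega_pos [Module.Finite (IwasawaAlgebra p) M] (hM : Module.IsTorsion (IwasawaAlgebra p) M) {f : IwasawaAlgebra p}
    (hchar : Literature.NumberTheory.EllipticCurves.Module.charIdeal (IwasawaAlgebra p) M = Ideal.span {f}) (h0 : PowerSeries.constantCoeff f ≠ 0) {n : ℕ}
    (hΨ : ∀ m < n, ¬ ((((Polynomial.cyclotomic (p ^ (m + 1)) ℤ_[p]).comp (Polynomial.X + 1) : ℤ_[p][X]) : IwasawaAlgebra p) ∣ f)) :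
    0 < Nat.card (M ⧸ (Ideal.span {((1 + PowerSeries.X : PowerSeries ℤ_[p]) ^ (p ^ n) - 1 : IwasawaAlgebra p)} • ⊤ : Submodule (IwasawaAlgebra p) M)) := by
  haveI : IsNoetherian (IwasawaAlgebra p) M := inferInstance
  obtain ⟨F, hFfin, hFmax⟩ := exists_finite_submodule_forall_finite_le (R := IwasawaAlgebra p) (M := M)
  haveI : Finite F := hFfin
  have hF := forall_finite_eq_bot_quotient_of_forall_finite_le F hFmax
  obtain ⟨hM', hchar'⟩ := isTorsion_and_charIdeal_quotient_eq hM F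
  rw [hchar] at hchar'
  rw [natCard_quotient_omega_eq_mul hM F hF hchar h0 hΨ]
  haveI : Finite (F ⧸ (Ideal.span {((1 + PowerSeries.X : PowerSeries ℤ_[p]) ^ (p ^ n) - 1 : IwasawaAlgebra p)} • ⊤ : Submodule (IwasawaAlgebra p) F)) :=
    Finite.of_surjective _ (Submodule.mkQ_surjective _)
  refine Nat.mul_pos ?_ Nat.card_pos
  rw [natCard_quotient_omega_eq_mul_prod hM' hF hchar' h0 hΨ]
  refine Nat.mul_pos (pow_valuation_dvd_natCard_quotient_X_smul_top hM' hchar' h0).2 (Finset.prod_pos fun m hm ↦ ?_)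
  have hm' : m < n := Finset.mem_range.mp hm
  rw [natCard_quotient_smul_top_eq_natCard_quotient_span_sup (constantCoeff_cyclotomicLayer p m) (prime_coe_cyclotomic_comp p m) hM' hF hchar' (hΨ m hm')]
  obtain ⟨v, hv⟩ := exists_natCard_quotient_span_sup_span_coe_eq_pow (constantCoeff_cyclotomicLayer p m) (prime_coe_cyclotomic_comp p m) (hΨ m hm')
  rw [hv]; exact pow_pos hp.out.pos _

/-- ★★ **`μ(f) = 0` in a rank-`0` tower ⟹ `∃ n₁, C > 0, ∀ n ≥ n₁: 0 < #(X/ω_nX) ≤ C·p^{λ(f)·n}`** (`C = #(X/ω_{n₁}X)`; gen 56's eventual Iwasawa formula with `μ = 0`).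
[cite: Washington1997, §13.3 Thm. 13.13] [cite: GreenbergLNM1716, Thm. 1.10] -/
theorem exists_forall_natCard_quotient_omega_pos_le [Module.Finite (IwasawaAlgebra p) M] (hM : Module.IsTorsion (IwasawaAlgebra p) M) {f : IwasawaAlgebra p}
    (hchar : Literature.NumberTheory.EllipticCurves.Module.charIdeal (IwasawaAlgebra p) M = Ideal.span {f}) (h0 : PowerSeries.constantCoeff f ≠ 0)
    (hΨ : ∀ m, ¬ ((((Polynomial.cyclotomic (p ^ (m + 1)) ℤ_[p]).comp (Polynomial.X + 1) : ℤ_[p][X]) : IwasawaAlgebra p) ∣ f)) (hμ : mu f = 0) :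
    ∃ n₁ C : ℕ, 0 < C ∧ ∀ n, n₁ ≤ n →
      0 < Nat.card (M ⧸ (Ideal.span {((1 + PowerSeries.X : PowerSeries ℤ_[p]) ^ (p ^ n) - 1 : IwasawaAlgebra p)} • ⊤ : Submodule (IwasawaAlgebra p) M)) ∧
      Nat.card (M ⧸ (Ideal.span {((1 + PowerSeries.X : PowerSeries ℤ_[p]) ^ (p ^ n) - 1 : IwasawaAlgebra p)} • ⊤ : Submodule (IwasawaAlgebra p) M)) ≤ C * p ^ (lam f * n) := by
  obtain ⟨n₁, h⟩ := exists_forall_natCard_quotient_omega_mul_pow_eq hM hchar h0 hΨ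
  refine ⟨n₁, Nat.card (M ⧸ (Ideal.span {((1 + PowerSeries.X : PowerSeries ℤ_[p]) ^ (p ^ n₁) - 1 : IwasawaAlgebra p)} • ⊤ : Submodule (IwasawaAlgebra p) M)),
    natCard_quotient_omega_pos hM hchar h0 (fun m _ ↦ hΨ m), fun n hn ↦ ⟨natCard_quotient_omega_pos hM hchar h0 (fun m _ ↦ hΨ m), ?_⟩⟩
  have e := h n hn
  rw [hμ, zero_mul, zero_add, zero_mul, zero_add] at e
  calc Nat.card (M ⧸ (Ideal.span {((1 + PowerSeries.X : PowerSeries ℤ_[p]) ^ (p ^ n) - 1 : IwasawaAlgebra p)} • ⊤ : Submodule (IwasawaAlgebra p) M))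
      ≤ Nat.card (M ⧸ (Ideal.span {((1 + PowerSeries.X : PowerSeries ℤ_[p]) ^ (p ^ n) - 1 : IwasawaAlgebra p)} • ⊤ : Submodule (IwasawaAlgebra p) M)) *
          p ^ (lam f * n₁) := Nat.le_mul_of_pos_right _ (pow_pos hp.out.pos _)
    _ = _ := e

variable (p) in
/-- `a·n + b < pⁿ` for all large `n` (from gen 55's `a·(n+1) + b < pⁿ(p−1)`). [folklore] -/
theorem exists_linear_lt_pow' (a b n₀ : ℕ) : ∃ n : ℕ, n₀ ≤ n ∧ a * n + b < p ^ n := by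
  obtain ⟨n, hn, hlt⟩ := exists_linear_lt_pow (p := p) a b n₀
  refine ⟨n + 1, by omega, hlt.trans_le ?_⟩
  rw [pow_succ]
  exact Nat.mul_le_mul_left _ (Nat.sub_le p 1)

/-- ★★ **`μ(f) = 0` in a rank-`0` tower ⟹ for every fixed `T > 0` there is a layer with `0 < #(X/ω_nX)·T < p^{pⁿ}`** (`C·p^{λn}·T < p^{λn + CT} ≤ p^{pⁿ}` once `λn + CT < pⁿ`).
[cite: Washington1997, §13.3 Thm. 13.13] [cite: GreenbergLNM1716, Conj. 1.11] -/
theorem exists_natCard_quotient_omega_mul_lt_pow [Module.Finite (IwasawaAlgebra p) M] (hM : Module.IsTorsion (IwasawaAlgebra p) M) {f : IwasawaAlgebra p}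
    (hchar : Literature.NumberTheory.EllipticCurves.Module.charIdeal (IwasawaAlgebra p) M = Ideal.span {f}) (h0 : PowerSeries.constantCoeff f ≠ 0)
    (hΨ : ∀ m, ¬ ((((Polynomial.cyclotomic (p ^ (m + 1)) ℤ_[p]).comp (Polynomial.X + 1) : ℤ_[p][X]) : IwasawaAlgebra p) ∣ f)) (hμ : mu f = 0) {T : ℕ} (hT : 0 < T) :
    ∃ n : ℕ, 0 < Nat.card (M ⧸ (Ideal.span {((1 + PowerSeries.X : PowerSeries ℤ_[p]) ^ (p ^ n) - 1 : IwasawaAlgebra p)} • ⊤ : Submodule (IwasawaAlgebra p) M)) * T ∧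
      Nat.card (M ⧸ (Ideal.span {((1 + PowerSeries.X : PowerSeries ℤ_[p]) ^ (p ^ n) - 1 : IwasawaAlgebra p)} • ⊤ : Submodule (IwasawaAlgebra p) M)) * T < p ^ (p ^ n) := by
  obtain ⟨n₁, C, hC, h⟩ := exists_forall_natCard_quotient_omega_pos_le hM hchar h0 hΨ hμ
  obtain ⟨n, hn, hlt⟩ := exists_linear_lt_pow' p (lam f) (C * T) n₁
  obtain ⟨hpos, hle⟩ := h n hn
  refine ⟨n, Nat.mul_pos hpos hT, ?_⟩
  have hCT : C * T < p ^ (C * T) := Nat.lt_pow_self hp.out.one_lt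
  calc Nat.card (M ⧸ (Ideal.span {((1 + PowerSeries.X : PowerSeries ℤ_[p]) ^ (p ^ n) - 1 : IwasawaAlgebra p)} • ⊤ : Submodule (IwasawaAlgebra p) M)) * T
      ≤ C * p ^ (lam f * n) * T := Nat.mul_le_mul_right _ hle
    _ = p ^ (lam f * n) * (C * T) := by ring
    _ < p ^ (lam f * n) * p ^ (C * T) := Nat.mul_lt_mul_of_pos_left hCT (pow_pos hp.out.pos _)
    _ = p ^ (lam f * n + C * T) := by rw [pow_add]
    _ ≤ p ^ (p ^ n) := Nat.pow_le_pow_right hp.out.pos hlt.le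

/-- ★★★ **THE `γ`-FREE CRITERION IN A RANK-`0` TOWER: `μ(f) = 0 ⟺ ∃ n, 0 < #(X/ω_nX) < p^{pⁿ}`** (`X` ANY f.g. torsion `Λ`-module, `char_Λ X = (f)`, `f` coprime to every `ω_n`).
Gen 55/56's criteria read `#(X/ω_{n+1}X) < p^{pⁿ(p−1)}` resp. `< p^{pⁿ(p−1)}·#(X/ω_nX)`; here ONE index against `p^{pⁿ}`. [cite: Washington1997, §13.3 Thm. 13.13] [cite: GreenbergLNM1716, Conj. 1.11] -/
theorem mu_eq_zero_iff_exists_natCard_quotient_omega_pos_lt [Module.Finite (IwasawaAlgebra p) M] (hM : Module.IsTorsion (IwasawaAlgebra p) M) {f : IwasawaAlgebra p}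
    (hchar : Literature.NumberTheory.EllipticCurves.Module.charIdeal (IwasawaAlgebra p) M = Ideal.span {f}) (h0 : PowerSeries.constantCoeff f ≠ 0)
    (hΨ : ∀ m, ¬ ((((Polynomial.cyclotomic (p ^ (m + 1)) ℤ_[p]).comp (Polynomial.X + 1) : ℤ_[p][X]) : IwasawaAlgebra p) ∣ f)) :
    mu f = 0 ↔ ∃ n : ℕ, 0 < Nat.card (M ⧸ (Ideal.span {((1 + PowerSeries.X : PowerSeries ℤ_[p]) ^ (p ^ n) - 1 : IwasawaAlgebra p)} • ⊤ : Submodule (IwasawaAlgebra p) M)) ∧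
      Nat.card (M ⧸ (Ideal.span {((1 + PowerSeries.X : PowerSeries ℤ_[p]) ^ (p ^ n) - 1 : IwasawaAlgebra p)} • ⊤ : Submodule (IwasawaAlgebra p) M)) < p ^ (p ^ n) := by
  have hf0 : f ≠ 0 := fun h ↦ h0 (by rw [h, map_zero])
  refine ⟨fun hμ ↦ ?_, fun ⟨n, hpos, hlt⟩ ↦ ?_⟩
  · obtain ⟨n, hpos, hlt⟩ := exists_natCard_quotient_omega_mul_lt_pow hM hchar h0 hΨ hμ Nat.one_pos
    rw [mul_one] at hpos hlt
    exact ⟨n, hpos, hlt⟩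
  · rw [Summit.BirchSwinnertonDyer.Rank1Residual.X1.MuPart.mu_generator_eq_muInvariant M hM hf0 hchar]
    exact muInvariant_eq_zero_of_natCard_quotient_omega_pos_lt hM hpos hlt

end Module

/-! ## §2 Selmer currency (any `K`, `p`, `κ`): completeness for the invariants and, with bounded `ker h`, for the honest finite-level product -/

section Selmer

variable {K : Type u} [Field K] [NumberField K] (W : WeierstrassCurve K) {p : ℕ} [hp : Fact p.Prime] (κ : ZpExtension K p)
  {γ : Field.absoluteGaloisGroup K}

/-- ★★★ **`μ(X(E/K_∞)) = 0 ⟺ ∃ n, 0 < #Sel_{p^∞}(E/K_∞)^{Γ_n} < p^{pⁿ}`** in a rank-`0` tower (`char_Λ X = (f)`, `f(0) ≠ 0`, `Ψ_m ∤ f`); `E/K`, any `ℤ_p`-extension with topological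
generator `γ`, any dual datum with `X` f.g. torsion. [cite: GreenbergLNM1716, §1 pp. 60–65, Thm. 1.10, Conj. 1.11] [cite: Washington1997, §13.3 Thm. 13.13] -/
theorem mu_eq_zero_iff_exists_natCard_selmerInvariants_pos_lt_pow (hγ : κ.IsTopGenerator γ) (D : W.SelmerDualData κ γ) [Module.Finite (IwasawaAlgebra p) D.X]
    (hD : D.IsTorsion) {f : IwasawaAlgebra p} (hchar : D.charIdeal = Ideal.span {f}) (h0 : PowerSeries.constantCoeff f ≠ 0)
    (hΨ : ∀ m, ¬ ((((Polynomial.cyclotomic (p ^ (m + 1)) ℤ_[p]).comp (Polynomial.X + 1) : ℤ_[p][X]) : IwasawaAlgebra p) ∣ f)) :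
    D.mu = 0 ↔ ∃ n : ℕ, 0 < Nat.card ↥(W.selmerInfty κ ⊓ W.layerInvariants κ n) ∧ Nat.card ↥(W.selmerInfty κ ⊓ W.layerInvariants κ n) < p ^ (p ^ n) := by
  have hf0 : f ≠ 0 := fun h ↦ h0 (by rw [h, map_zero])
  have hμ : D.mu = mu f := (Summit.BirchSwinnertonDyer.Rank1Residual.X1.MuPart.mu_generator_eq_muInvariant D.X hD hf0 hchar).symm
  rw [hμ, mu_eq_zero_iff_exists_natCard_quotient_omega_pos_lt (M := D.X) hD hchar h0 hΨ]
  simp only [natCard_layerQuotient_omega_eq_natCard_selmerInvariants W κ hγ D]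

/-- ★★ **`μ = 0` in a rank-`0` tower with `#ker h_n` positive and bounded ⟹ `∃ n, 0 < #Sel_{p^∞}(E/K_n)·#ker g_n < p^{pⁿ}`** (Lemma 4.3: the product is `#Sel_∞^{Γ_n}·#ker h_n`; NO
bound on `#ker g_n` is needed). [cite: GreenbergLNM1716, §3 Lemma 3.1, §4 Lemma 4.3, Conj. 1.11] [cite: Washington1997, §13.3 Thm. 13.13] -/
theorem exists_natCard_selmerLayer_mul_kerG_lt_of_mu_eq_zero (hγ : κ.IsTopGenerator γ) (D : W.SelmerDualData κ γ) [Module.Finite (IwasawaAlgebra p) D.X]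
    (hD : D.IsTorsion) {f : IwasawaAlgebra p} (hchar : D.charIdeal = Ideal.span {f}) (h0 : PowerSeries.constantCoeff f ≠ 0)
    (hΨ : ∀ m, ¬ ((((Polynomial.cyclotomic (p ^ (m + 1)) ℤ_[p]).comp (Polynomial.X + 1) : ℤ_[p][X]) : IwasawaAlgebra p) ∣ f)) (hμ : D.mu = 0)
    (hh : ∃ T : ℕ, ∀ n, 0 < Nat.card (W.layerToInfty κ n).ker ∧ Nat.card (W.layerToInfty κ n).ker ≤ T) :
    ∃ n : ℕ, 0 < Nat.card ↥(W.selmerLayer κ n) * Nat.card (W.KerG κ n) ∧ Nat.card ↥(W.selmerLayer κ n) * Nat.card (W.KerG κ n) < p ^ (p ^ n) := by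
  obtain ⟨T, hT⟩ := hh
  have hf0 : f ≠ 0 := fun h ↦ h0 (by rw [h, map_zero])
  have hμ' : mu f = 0 := by rw [Summit.BirchSwinnertonDyer.Rank1Residual.X1.MuPart.mu_generator_eq_muInvariant D.X hD hf0 hchar]; exact hμ
  have hTpos : 0 < T := (hT 0).1.trans_le (hT 0).2
  obtain ⟨n, hpos, hlt⟩ := exists_natCard_quotient_omega_mul_lt_pow (M := D.X) hD hchar h0 hΨ hμ' hTpos
  rw [natCard_layerQuotient_omega_eq_natCard_selmerInvariants W κ hγ D n] at hpos hlt
  have h43 := W.natCard_selmerInvariants_mul_natCard_ker_layerToInfty κ n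
  refine ⟨n, ?_, ?_⟩
  · rw [← h43]
    exact Nat.mul_pos (Nat.pos_of_mul_pos_right hpos) (hT n).1
  · rw [← h43]
    exact (Nat.mul_le_mul_left _ (hT n).2).trans_lt hlt

/-- ★★★ **THE `γ`-FREE DOOR IS COMPLETE UNDER BOUNDED `ker h`: `μ(X(E/K_∞)) = 0 ⟺ ∃ n, 0 < #Sel_{p^∞}(E/K_n)·#ker g_n < p^{pⁿ}`** in a rank-`0` tower — `E/K`, any `p`, any `ℤ_p`-extension,
any dual datum with `X` f.g. torsion, restriction kernels positive and bounded (over `ℚ`: always, §3). Greenberg's control kernel `ker g_n` needs NO bound.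
[cite: GreenbergLNM1716, §3 Lemma 3.1, §4 Lemma 4.3, Conj. 1.11] [cite: Washington1997, §13.3 Thm. 13.13] -/
theorem mu_eq_zero_iff_exists_natCard_selmerLayer_mul_kerG_lt (hγ : κ.IsTopGenerator γ) (D : W.SelmerDualData κ γ) [Module.Finite (IwasawaAlgebra p) D.X]
    (hD : D.IsTorsion) {f : IwasawaAlgebra p} (hchar : D.charIdeal = Ideal.span {f}) (h0 : PowerSeries.constantCoeff f ≠ 0)
    (hΨ : ∀ m, ¬ ((((Polynomial.cyclotomic (p ^ (m + 1)) ℤ_[p]).comp (Polynomial.X + 1) : ℤ_[p][X]) : IwasawaAlgebra p) ∣ f))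
    (hh : ∃ T : ℕ, ∀ n, 0 < Nat.card (W.layerToInfty κ n).ker ∧ Nat.card (W.layerToInfty κ n).ker ≤ T) :
    D.mu = 0 ↔ ∃ n : ℕ, 0 < Nat.card ↥(W.selmerLayer κ n) * Nat.card (W.KerG κ n) ∧ Nat.card ↥(W.selmerLayer κ n) * Nat.card (W.KerG κ n) < p ^ (p ^ n) :=
  ⟨fun hμ ↦ exists_natCard_selmerLayer_mul_kerG_lt_of_mu_eq_zero W κ hγ D hD hchar h0 hΨ hμ hh,
    fun ⟨_, hpos, hlt⟩ ↦ mu_eq_zero_of_natCard_selmerLayer_mul_kerG_pos_lt W κ hγ D hD hpos hlt⟩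

end Selmer

/-! ## §3 `K = ℚ`: the `γ`-free door is complete at every prime, for every curve and every reduction type -/

section Rat

variable (W : WeierstrassCurve ℚ) [W.IsElliptic] {p : ℕ} [hp : Fact p.Prime] (κ : ZpExtension ℚ p) {γ : Field.absoluteGaloisGroup ℚ}

/-- ★★★ **OVER `ℚ` THE `γ`-FREE DOOR IS COMPLETE, UNCONDITIONALLY: `μ(X(E/ℚ_∞)) = 0 ⟺ ∃ n, 0 < #Sel_{p^∞}(E/ℚ_n)·#ker g_n(E/ℚ_n) < p^{pⁿ}`** for every elliptic `E/ℚ`, every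
prime `p`, every `ℤ_p`-extension `κ` of `ℚ` with topological generator `γ`, and every Pontryagin-dual datum in a rank-`0` tower (`char X = (f)`, `f(0) ≠ 0`, `Ψ_m ∤ f`) — the
restriction kernels are bounded over `ℚ` by the tree (`#ker h_n = #E[p^∞]^{Gal(ℚ̄/ℚ_n)} ≤ #E(ℚ_∞)[p^∞] < ∞`), and `X` is finitely generated by the tree. NO reduction
hypothesis at `p` (gen 57's finite-level door is complete over `ℚ` only at good ORDINARY `2`). [cite: GreenbergLNM1716, §3 Lemma 3.1, §4 Lemma 4.3, Conj. 1.11]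
[cite: Washington1997, §13.3 Thm. 13.13] [cite: Mazur1972, §6] -/
theorem mu_eq_zero_iff_exists_natCard_selmerLayer_mul_kerG_lt_rat (hγ : κ.IsTopGenerator γ) (D : W.SelmerDualData κ γ) (hD : D.IsTorsion) {f : IwasawaAlgebra p}
    (hchar : D.charIdeal = Ideal.span {f}) (h0 : PowerSeries.constantCoeff f ≠ 0)
    (hΨ : ∀ m, ¬ ((((Polynomial.cyclotomic (p ^ (m + 1)) ℤ_[p]).comp (Polynomial.X + 1) : ℤ_[p][X]) : IwasawaAlgebra p) ∣ f)) :
    D.mu = 0 ↔ ∃ n : ℕ, 0 < Nat.card ↥(W.selmerLayer κ n) * Nat.card (W.KerG κ n) ∧ Nat.card ↥(W.selmerLayer κ n) * Nat.card (W.KerG κ n) < p ^ (p ^ n) := by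
  haveI : Module.Finite (IwasawaAlgebra p) D.X := D.module_finite_holds hγ
  exact mu_eq_zero_iff_exists_natCard_selmerLayer_mul_kerG_lt W κ hγ D hD hchar h0 hΨ (exists_forall_natCard_ker_layerToInfty_pos_le W κ)

/-- ★★★ Over `ℚ`, unconditionally and in ANY tower (no rank hypothesis): **`p^{pⁿ·μ(X(E/ℚ_∞))} ∣ #Sel_{p^∞}(E/ℚ_n)·#ker g_n(E/ℚ_n)`** for every elliptic `E/ℚ`, prime `p`,
`ℤ_p`-extension `κ` with topological generator `γ`, dual datum with `X` torsion, and every `n` (file III with `X` f.g. by the tree). [cite: GreenbergLNM1716, Conj. 1.11, §4 Lemma 4.3] -/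
theorem pow_mul_mu_dvd_natCard_selmerLayer_mul_kerG_rat (hγ : κ.IsTopGenerator γ) (D : W.SelmerDualData κ γ) (hD : D.IsTorsion) (n : ℕ) :
    p ^ (p ^ n * D.mu) ∣ Nat.card ↥(W.selmerLayer κ n) * Nat.card (W.KerG κ n) := by
  haveI : Module.Finite (IwasawaAlgebra p) D.X := D.module_finite_holds hγ
  exact pow_mul_mu_dvd_natCard_selmerLayer_mul_kerG W κ hγ D hD n

end Rat

end Summit.BirchSwinnertonDyer.BirchSwinnertonDyer.Theorems.AlignedTransportAtTwoHalfDescentBaseIndexComplete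

end
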